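import Literature.NumberTheory.LFunctions.CharacterHarmonicTails
import Mathlib.NumberTheory.LSeries.Nonvanishing
import Mathlib.NumberTheory.Harmonic.EulerMascheroni
import Mathlib.NumberTheory.Harmonic.Bounds
import HarnessLib

/-!
# The harmonic mean value of `ζ ⋆ χ`:
# `∑_{n ≤ x} (1 ∗ χ)(n)/n = L'(1, χ) + (log x + γ) L(1, χ) + O(W log x/y + y/x)`

Topic `Literature/NumberTheory/LFunctions`. Everything in this file is PROVED (theorems only).

Let `χ ≠ χ₀` be a quadratic Dirichlet character mod `q` whose window sums are bounded by `W`
(`|∑_{N<n≤M} χ(n)| ≤ W`; `W = √q(1 + log q)` for primitive `χ` by Pólya–Vinogradov,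
`Literature.NumberTheory.LFunctions.CharacterTails.norm_window_le_polyaVinogradov`). Writing
`(1 ∗ χ)(n)/n = ∑_{db = n} χ(d)/d · 1/b` and splitting at `d ≤ y` (Dirichlet's hyperbola method,
Montgomery–Vaughan §2.1) we prove the classical asymptotic with explicit error terms:

* `harmonic_bounds` — `log m + γ ≤ H_m ≤ log m + γ + 1/m` (Mathlib's Euler–Mascheroni bounds);
* `sum_zetaMul_re_div_eq` — `∑_{n ≤ x} (1∗χ)(n)/n = ∑_{d ≤ x} χ(d)/d · H_{⌊x/d⌋}`
  (for the rearrangement at `s = β` see the tree's `SiegelZero.sum_re_zetaMul_mul_rpow_eq`);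
* `sum_Ioc_eq_sum_swap` — `∑_{y<d≤x} χ(d)/d H_{⌊x/d⌋} = ∑_{b ≤ x/(y+1)} (1/b) ∑_{y<d≤x/b} χ(d)/d`;
* `abs_sum_zetaMul_re_div_sub_le` — **the mean value**: for `2 ≤ y ≤ x`,
  `|∑_{n ≤ x} (1∗χ)(n)/n − (L'(1,χ) + (log x + γ) L(1,χ))| ≤ 3W(1 + log x)/(y+1) + 2y/x`.

With `W ≍ √q log q` and `y ≍ √(Wx)` this is Montgomery–Vaughan's
`∑_{n ≤ x}(1∗χ)(n)/n = (log x + γ)L(1,χ) + L'(1,χ) + O_ε(q^{-ε/10})` for `x ≥ q^{(1+ε)/2}`, the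
input of Tao–Teräväinen's Proposition 3.5; in this tree it feeds the discharge of
Granville–Mollin's Proposition 2 (`Literature.Barriers.Parity.GranvilleMollin2000_prop2`).

## References

* H. L. Montgomery, R. C. Vaughan, *Multiplicative Number Theory I*, CUP 2007, §2.1 (hyperbola
  method), §4.3 Thm. 4.8 [MontgomeryVaughan2007].
* T. Tao, J. Teräväinen, *The Hardy–Littlewood–Chowla conjecture in the presence of a Siegel
  zero*, J. London Math. Soc. (2) 106 (2022), §3, proof of Proposition 3.5 [TaoTeravainen2021].
-/

noncomputable section

open Complex Filter Topology Finset
open Literature.NumberTheory.LFunctions.DirichletAbel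

namespace Literature.NumberTheory.LFunctions.ZetaMulHarmonic

/-! ### Harmonic numbers -/

/-- **`log m + γ ≤ H_m ≤ log m + γ + 1/m`** for `m ≥ 1` (Mathlib: `γ < H_m − log m` and
`H_m − log(m+1) < γ`, with `log(m+1) ≤ log m + 1/m`). [folklore] -/
theorem harmonic_bounds {m : ℕ} (hm : 1 ≤ m) :
    Real.log m + Real.eulerMascheroniConstant ≤ (harmonic m : ℝ) ∧
      (harmonic m : ℝ) ≤ Real.log m + Real.eulerMascheroniConstant + 1 / m := by
  have hm0 : m ≠ 0 := by omega
  have hm0' : (0 : ℝ) < m := by exact_mod_cast hm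
  have h1 : Real.eulerMascheroniConstant < (harmonic m : ℝ) - Real.log m := by
    have := Real.eulerMascheroniConstant_lt_eulerMascheroniSeq' m
    rwa [Real.eulerMascheroniSeq', if_neg hm0] at this
  have h2 : (harmonic m : ℝ) - Real.log (m + 1) < Real.eulerMascheroniConstant := by
    have := Real.eulerMascheroniSeq_lt_eulerMascheroniConstant m
    simpa [Real.eulerMascheroniSeq] using this
  have h3 : Real.log ((m : ℝ) + 1) ≤ Real.log m + 1 / m := by
    have e : Real.log ((m : ℝ) + 1) - Real.log m = Real.log (1 + 1 / m) := by
      rw [← Real.log_div (by positivity) hm0'.ne']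
      congr 1; field_simp
    have := Real.log_le_sub_one_of_pos (show (0 : ℝ) < 1 + 1 / m by positivity)
    linarith
  constructor <;> linarith

/-- `H_m = ∑_{b ≤ m} 1/b` as a real sum over `Icc 1 m`. [folklore] -/
theorem harmonic_eq_sum_Icc_real (m : ℕ) : (harmonic m : ℝ) = ∑ b ∈ Icc 1 m, (1 : ℝ) / b := by
  rw [harmonic_eq_sum_Icc]
  push_cast
  refine Finset.sum_congr rfl fun b _ => ?_
  rw [one_div]

/-! ### The weighted hyperbola identity -/

variable {q : ℕ} (χ : DirichletCharacter ℂ q)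

/-- The multiples of `d ≥ 1` in `(0, x]` are `d·(0, x/d]`. [folklore] -/
theorem filter_dvd_Ioc_eq_image {d : ℕ} (hd : 0 < d) (x : ℕ) :
    (Ioc 0 x).filter (d ∣ ·) = (Ioc 0 (x / d)).image (d * ·) := by
  ext n
  simp only [Finset.mem_filter, Finset.mem_Ioc, Finset.mem_image]
  constructor
  · rintro ⟨⟨hn0, hnx⟩, ⟨b, rfl⟩⟩
    refine ⟨b, ⟨Nat.pos_of_ne_zero fun hb => by simp [hb] at hn0, ?_⟩, rfl⟩
    exact (Nat.le_div_iff_mul_le hd).mpr (by rw [mul_comm]; exact hnx)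
  · rintro ⟨b, ⟨hb0, hbx⟩, rfl⟩
    refine ⟨⟨Nat.mul_pos hd hb0, ?_⟩, dvd_mul_right d b⟩
    have := (Nat.le_div_iff_mul_le hd).mp hbx
    rw [mul_comm]; exact this

/-- **The weighted hyperbola identity**:
`∑_{n ≤ x} (1 ∗ χ)(n)/n = ∑_{d ≤ x} (χ(d)/d) · H_{⌊x/d⌋}` (`n = db`, `1/n = (1/d)(1/b)`).
[cite: MontgomeryVaughan2007, §2.1] -/
theorem sum_zetaMul_re_div_eq (x : ℕ) :
    ∑ n ∈ Icc 1 x, (χ.zetaMul n).re / n =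
      ∑ d ∈ Icc 1 x, (χ (d : ZMod q)).re / d * (harmonic (x / d) : ℝ) := by
  have hI : Icc 1 x = Ioc 0 x := by ext n; simp only [Finset.mem_Icc, Finset.mem_Ioc]; omega
  rw [hI]
  -- `Re (1 ∗ χ)(n) = ∑_{d ∣ n} Re χ(d)` (as in the tree's `SiegelZero.re_zetaMul_apply`)
  have hre : ∀ n : ℕ, (χ.zetaMul n).re = ∑ d ∈ n.divisors, (χ (d : ZMod q)).re := by
    intro n
    rw [DirichletCharacter.zetaMul, ArithmeticFunction.coe_zeta_mul_apply, Complex.re_sum]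
    refine Finset.sum_congr rfl fun d hd => ?_
    have hd0 : d ≠ 0 := (Nat.pos_of_mem_divisors hd).ne'
    simp [toArithmeticFunction, hd0]
  have h1 : ∀ n ∈ Ioc 0 x, (χ.zetaMul n).re / n = ∑ d ∈ n.divisors, (χ (d : ZMod q)).re / n := by
    intro n _
    rw [hre, Finset.sum_div]
  rw [Finset.sum_congr rfl h1,
    Finset.sum_comm' (t' := Ioc 0 x) (s' := fun d => (Ioc 0 x).filter (d ∣ ·))]
  · refine Finset.sum_congr rfl fun d hd => ?_
    have hd0 : 0 < d := (Finset.mem_Ioc.mp hd).1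
    have hd0' : (d : ℝ) ≠ 0 := by exact_mod_cast hd0.ne'
    rw [filter_dvd_Ioc_eq_image hd0, Finset.sum_image (fun a _ b _ h => Nat.eq_of_mul_eq_mul_left hd0 h),
      harmonic_eq_sum_Icc_real, Finset.mul_sum]
    have hI' : Icc 1 (x / d) = Ioc 0 (x / d) := by
      ext n; simp only [Finset.mem_Icc, Finset.mem_Ioc]; omega
    rw [hI']
    refine Finset.sum_congr rfl fun b hb => ?_
    have hb0 : (b : ℝ) ≠ 0 := by exact_mod_cast (Finset.mem_Ioc.mp hb).1.ne'
    push_cast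
    field_simp
  · intro n d
    simp only [Finset.mem_Ioc, Nat.mem_divisors, Finset.mem_filter]
    constructor
    · rintro ⟨⟨hn0, hnN⟩, hdn, hn⟩
      have hd0 : 0 < d := Nat.pos_of_ne_zero fun h => hn (Nat.eq_zero_of_zero_dvd (h ▸ hdn))
      exact ⟨⟨⟨hn0, hnN⟩, hdn⟩, hd0, (Nat.le_of_dvd hn0 hdn).trans hnN⟩
    · rintro ⟨⟨⟨hn0, hnN⟩, hdn⟩, _, _⟩
      exact ⟨⟨hn0, hnN⟩, hdn, Nat.pos_iff_ne_zero.mp hn0⟩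

/-- **Swapping the tail**: for `1 ≤ y ≤ x`,
`∑_{y<d≤x} (χ(d)/d) H_{⌊x/d⌋} = ∑_{b ≤ x/(y+1)} (1/b) ∑_{y<d≤x/b} χ(d)/d`. [cite: MontgomeryVaughan2007, §2.1] -/
theorem sum_Ioc_eq_sum_swap (x y : ℕ) :
    ∑ d ∈ Ioc y x, (χ (d : ZMod q)).re / d * (harmonic (x / d) : ℝ) =
      ∑ b ∈ Icc 1 (x / (y + 1)), (1 : ℝ) / b * ∑ d ∈ Ioc y (x / b), (χ (d : ZMod q)).re / d := by
  have h1 : ∀ d ∈ Ioc y x, (χ (d : ZMod q)).re / d * (harmonic (x / d) : ℝ) =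
      ∑ b ∈ Icc 1 (x / d), (χ (d : ZMod q)).re / d * ((1 : ℝ) / b) := by
    intro d _
    rw [harmonic_eq_sum_Icc_real, Finset.mul_sum]
  rw [Finset.sum_congr rfl h1,
    Finset.sum_comm' (t' := Icc 1 (x / (y + 1))) (s' := fun b => Ioc y (x / b))]
  · refine Finset.sum_congr rfl fun b _ => ?_
    rw [Finset.mul_sum]
    refine Finset.sum_congr rfl fun d _ => ?_
    ring
  · intro d b
    simp only [Finset.mem_Ioc, Finset.mem_Icc]
    constructor
    · rintro ⟨⟨hyd, hdx⟩, hb1, hbxd⟩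
      have hd0 : 0 < d := by omega
      have hb0 : 0 < b := hb1
      have hbd : b * d ≤ x := (Nat.le_div_iff_mul_le hd0).mp hbxd
      refine ⟨⟨hyd, ?_⟩, hb1, ?_⟩
      · exact (Nat.le_div_iff_mul_le hb0).mpr (by rw [mul_comm]; exact hbd)
      · exact (Nat.le_div_iff_mul_le (Nat.succ_pos y)).mpr
          (le_trans (Nat.mul_le_mul_left b hyd) hbd)
    · rintro ⟨⟨hyd, hdxb⟩, hb1, _⟩
      have hb0 : 0 < b := hb1
      have hd0 : 0 < d := by omega
      have hdb : d * b ≤ x := (Nat.le_div_iff_mul_le hb0).mp hdxb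
      refine ⟨⟨hyd, le_trans (Nat.le_mul_of_pos_right d hb0) hdb⟩, hb1, ?_⟩
      exact (Nat.le_div_iff_mul_le hd0).mpr (by rw [mul_comm]; exact hdb)

/-! ### Real parts of the character sums -/

/-- A quadratic character is real-valued: `Re` commutes with the weighted sums. [folklore] -/
theorem sum_re_div_eq_re_sum (hq : χ ^ 2 = 1) (s : Finset ℕ) (a : ℕ → ℝ) :
    ∑ n ∈ s, (χ (n : ZMod q)).re * a n = (∑ n ∈ s, χ (n : ZMod q) * (a n : ℂ)).re := by
  rw [Complex.re_sum]
  refine Finset.sum_congr rfl fun n _ => ?_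
  rw [SiegelZero.apply_eq_ofReal_re χ hq, ← Complex.ofReal_mul, Complex.ofReal_re, Complex.ofReal_re]

/-! ### The mean value -/

/-- **The harmonic mean value of `ζ ⋆ χ`** (hyperbola method): let `χ ≠ χ₀` be quadratic mod `q`
with window sums `|∑_{N<n≤M} χ(n)| ≤ W` for all `N, M`; then for `2 ≤ y ≤ x`,
`|∑_{n ≤ x} (1∗χ)(n)/n − (L'(1, χ) + (log x + γ) L(1, χ))| ≤ 3W(1 + log x)/(y+1) + 2y/x`.
Proof: `H_{⌊x/d⌋} = log x − log d + γ + O(d/x)` for `d ≤ y` (harmonic bounds), the head gives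
`(log x + γ)∑_{d≤y}χ(d)/d − ∑_{d≤y}χ(d)log d/d`, which are `L(1,χ)`, `−L'(1,χ)` up to
`W/(y+1)`, `W log(y+1)/(y+1)` (`CharacterHarmonicTails.lean`); the tail, after swapping, is
`≤ H_x · W/(y+1)`. [cite: MontgomeryVaughan2007, §2.1 and §4.3 Thm. 4.8] -/
theorem abs_sum_zetaMul_re_div_sub_le [NeZero q] (hχ : χ ≠ 1) (hq : χ ^ 2 = 1) {W : ℝ}
    (hW : ∀ N n : ℕ, ‖∑ k ∈ Ioc N n, χ (k : ZMod q)‖ ≤ W) {x y : ℕ} (hy : 2 ≤ y) (hyx : y ≤ x) :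
    |∑ n ∈ Icc 1 x, (χ.zetaMul n).re / n -
        ((deriv χ.LFunction 1).re +
          (Real.log x + Real.eulerMascheroniConstant) * (χ.LFunction 1).re)| ≤
      3 * W * (1 + Real.log x) / (y + 1) + 2 * y / x := by
  set γ : ℝ := Real.eulerMascheroniConstant with hγ
  set L₁ : ℝ := (χ.LFunction 1).re with hL₁
  set L₁' : ℝ := (deriv χ.LFunction 1).re with hL₁'
  have hW0 : 0 ≤ W := le_trans (norm_nonneg _) (hW 0 0)
  have hx1 : 1 ≤ x := le_trans (by omega) hyx
  have hx0 : (0 : ℝ) < x := by exact_mod_cast hx1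
  have hy0 : (0 : ℝ) < y := by exact_mod_cast (show 0 < y by omega)
  have hy1 : (0 : ℝ) < (y : ℝ) + 1 := by linarith
  have hlogx : 0 ≤ Real.log x := Real.log_natCast_nonneg x
  have hγ0 : 0 < γ := lt_trans (by norm_num) Real.one_half_lt_eulerMascheroniConstant
  have hγ1 : γ < 1 := lt_trans Real.eulerMascheroniConstant_lt_two_thirds (by norm_num)
  -- abbreviations for the character sums
  set A : ℝ := ∑ d ∈ Icc 1 y, (χ (d : ZMod q)).re / d with hA
  set B : ℝ := ∑ d ∈ Icc 1 y, (χ (d : ZMod q)).re * (Real.log d / d) with hB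
  -- (1) the tails `A ≈ L₁`, `B ≈ −L₁'`
  have hAL : |A - L₁| ≤ W / ((y : ℝ) + 1) := by
    have h := CharacterTails.norm_sum_Icc_div_sub_LFunction_one_le χ hχ (hW y)
    have hre : A - L₁ = (∑ n ∈ Icc 1 y, χ (n : ZMod q) / n - χ.LFunction 1).re := by
      rw [Complex.sub_re, hA, hL₁, Complex.re_sum]
      congr 1
      refine Finset.sum_congr rfl fun n _ => ?_
      rw [SiegelZero.apply_eq_ofReal_re χ hq, ← Complex.ofReal_natCast, ← Complex.ofReal_div,
        Complex.ofReal_re, Complex.ofReal_re]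
    rw [hre]
    exact (Complex.abs_re_le_norm _).trans h
  have hBL : |B + L₁'| ≤ W * (1 + Real.log x) / ((y : ℝ) + 1) := by
    have h := CharacterTails.norm_sum_Icc_mul_log_div_add_deriv_le χ hχ hy (hW y)
    have hre : B + L₁' = (∑ n ∈ Icc 1 y, χ (n : ZMod q) * ((Real.log n / n : ℝ) : ℂ) +
        deriv χ.LFunction 1).re := by
      rw [Complex.add_re, hB, hL₁', sum_re_div_eq_re_sum χ hq]
    rw [hre]
    refine ((Complex.abs_re_le_norm _).trans h).trans ?_
    -- `log(y+1)/(y+1) ≤ (1 + log x)/(y+1)`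
    have hx1' : (1 : ℝ) ≤ x := by exact_mod_cast hx1
    have hyx' : (y : ℝ) ≤ x := by exact_mod_cast hyx
    have hlog : Real.log ((y : ℝ) + 1) ≤ 1 + Real.log x := by
      have h2 : (y : ℝ) + 1 ≤ 2 * x := by linarith
      calc Real.log ((y : ℝ) + 1) ≤ Real.log (2 * x) := Real.log_le_log (by positivity) h2
        _ = Real.log 2 + Real.log x := Real.log_mul (by norm_num) hx0.ne'
        _ ≤ 1 + Real.log x := by linarith [Real.log_two_lt_d9]
    have : W * (Real.log (y + 1 : ℕ) / (y + 1 : ℕ)) ≤ W * ((1 + Real.log x) / ((y : ℝ) + 1)) := by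
      refine mul_le_mul_of_nonneg_left ?_ hW0
      push_cast
      exact div_le_div_of_nonneg_right hlog hy1.le
    rw [mul_div_assoc]
    exact this
  -- (2) the hyperbola identity and the split at `y`
  have hI : Icc 1 x = Ioc 0 x := by ext n; simp only [Finset.mem_Icc, Finset.mem_Ioc]; omega
  have hIy : Icc 1 y = Ioc 0 y := by ext n; simp only [Finset.mem_Icc, Finset.mem_Ioc]; omega
  have hsplit : ∑ n ∈ Icc 1 x, (χ.zetaMul n).re / n =
      ∑ d ∈ Icc 1 y, (χ (d : ZMod q)).re / d * (harmonic (x / d) : ℝ) +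
        ∑ d ∈ Ioc y x, (χ (d : ZMod q)).re / d * (harmonic (x / d) : ℝ) := by
    rw [sum_zetaMul_re_div_eq χ, hI, hIy, ← Finset.sum_Ioc_consecutive _ (Nat.zero_le y) hyx]
  -- (3) the tail
  have htail : |∑ d ∈ Ioc y x, (χ (d : ZMod q)).re / d * (harmonic (x / d) : ℝ)| ≤
      W * (1 + Real.log x) / ((y : ℝ) + 1) := by
    rw [sum_Ioc_eq_sum_swap]
    have hinner : ∀ b ∈ Icc 1 (x / (y + 1)),
        |(1 : ℝ) / b * ∑ d ∈ Ioc y (x / b), (χ (d : ZMod q)).re / d| ≤ (1 : ℝ) / b * (W / ((y : ℝ) + 1)) := by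
      intro b hb
      have hb0 : (0 : ℝ) < b := by exact_mod_cast (Finset.mem_Icc.mp hb).1
      rw [abs_mul, abs_of_pos (by positivity : (0 : ℝ) < 1 / b)]
      refine mul_le_mul_of_nonneg_left ?_ (by positivity)
      have h := CharacterTails.norm_sum_Ioc_mul_le_of_window χ (hW y) (a := fun n : ℕ => (1 : ℝ) / n)
        (fun n _ => by positivity)
        (fun n hn => by
          have hn0 : (0 : ℝ) < n := by exact_mod_cast (Nat.zero_le y).trans_lt hn
          push_cast
          exact one_div_le_one_div_of_le hn0 (by linarith)) (x / b)
      have hre : ∑ d ∈ Ioc y (x / b), (χ (d : ZMod q)).re / d =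
          (∑ n ∈ Ioc y (x / b), χ (n : ZMod q) * (((1 : ℝ) / n : ℝ) : ℂ)).re := by
        rw [← sum_re_div_eq_re_sum χ hq]
        refine Finset.sum_congr rfl fun n _ => ?_
        rw [div_eq_mul_one_div]
      rw [hre]
      refine ((Complex.abs_re_le_norm _).trans h).trans (le_of_eq ?_)
      push_cast
      ring
    calc |∑ b ∈ Icc 1 (x / (y + 1)), (1 : ℝ) / b * ∑ d ∈ Ioc y (x / b), (χ (d : ZMod q)).re / d|
        ≤ ∑ b ∈ Icc 1 (x / (y + 1)), |(1 : ℝ) / b * ∑ d ∈ Ioc y (x / b), (χ (d : ZMod q)).re / d| :=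
          Finset.abs_sum_le_sum_abs _ _
      _ ≤ ∑ b ∈ Icc 1 (x / (y + 1)), (1 : ℝ) / b * (W / ((y : ℝ) + 1)) := Finset.sum_le_sum hinner
      _ = (harmonic (x / (y + 1)) : ℝ) * (W / ((y : ℝ) + 1)) := by
          rw [← Finset.sum_mul, harmonic_eq_sum_Icc_real]
      _ ≤ (1 + Real.log x) * (W / ((y : ℝ) + 1)) := by
          refine mul_le_mul_of_nonneg_right ?_ (by positivity)
          refine (harmonic_le_one_add_log _).trans ?_
          have hle : ((x / (y + 1) : ℕ) : ℝ) ≤ x := by exact_mod_cast Nat.div_le_self x (y + 1)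
          rcases Nat.eq_zero_or_pos (x / (y + 1)) with h0 | h0
          · rw [h0]; simp [hlogx]
          · have : (0 : ℝ) < ((x / (y + 1) : ℕ) : ℝ) := by exact_mod_cast h0
            linarith [Real.log_le_log this hle]
      _ = W * (1 + Real.log x) / ((y : ℝ) + 1) := by ring
  -- (4) the head: `H_{⌊x/d⌋} = log x − log d + γ + ρ_d`, `|ρ_d| ≤ 2d/x`
  have hhead : |∑ d ∈ Icc 1 y, (χ (d : ZMod q)).re / d * (harmonic (x / d) : ℝ) -
      ((Real.log x + γ) * A - B)| ≤ 2 * y / x := by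
    have hterm : ∀ d ∈ Icc 1 y, |(χ (d : ZMod q)).re / d * (harmonic (x / d) : ℝ) -
        ((Real.log x + γ) * ((χ (d : ZMod q)).re / d) - (χ (d : ZMod q)).re * (Real.log d / d))| ≤ 2 / x := by
      intro d hd
      obtain ⟨hd1, hdy⟩ := Finset.mem_Icc.mp hd
      have hd0 : (0 : ℝ) < d := by exact_mod_cast hd1
      have hdx : d ≤ x := le_trans hdy hyx
      set m : ℕ := x / d with hm
      have hm1 : 1 ≤ m := (Nat.le_div_iff_mul_le hd1).mpr (by rw [one_mul]; exact hdx)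
      have hm0 : (0 : ℝ) < m := by exact_mod_cast hm1
      -- `m ≤ x/d < m + 1`
      have hmle : (m : ℝ) ≤ (x : ℝ) / d := by
        rw [le_div_iff₀ hd0]; exact_mod_cast Nat.div_mul_le_self x d
      have hmlt : (x : ℝ) / d < m + 1 := by
        rw [div_lt_iff₀ hd0]
        have h := Nat.lt_div_mul_add (a := x) hd1
        have h' : (x : ℝ) < (m : ℝ) * d + d := by rw [hm]; exact_mod_cast h
        linarith
      -- `|H_m − (log x − log d + γ)| ≤ 1/m ≤ 2d/x`
      obtain ⟨hH1, hH2⟩ := harmonic_bounds hm1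
      have hlogm_le : Real.log m ≤ Real.log x - Real.log d := by
        rw [← Real.log_div hx0.ne' hd0.ne']; exact Real.log_le_log hm0 hmle
      have hlogm_ge : Real.log x - Real.log d - 1 / m ≤ Real.log m := by
        have h1 : Real.log ((x : ℝ) / d) ≤ Real.log ((m : ℝ) + 1) :=
          Real.log_le_log (by positivity) hmlt.le
        have h2 : Real.log ((m : ℝ) + 1) ≤ Real.log m + 1 / m := by
          have e : Real.log ((m : ℝ) + 1) - Real.log m = Real.log (1 + 1 / m) := by
            rw [← Real.log_div (by positivity) hm0.ne']
            congr 1; field_simp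
          have := Real.log_le_sub_one_of_pos (show (0 : ℝ) < 1 + 1 / m by positivity)
          linarith
        rw [Real.log_div hx0.ne' hd0.ne'] at h1
        linarith
      have hinvm : 1 / (m : ℝ) ≤ 2 * d / x := by
        rw [div_le_div_iff₀ hm0 hx0]
        have : (x : ℝ) < (m + 1) * d := by rwa [div_lt_iff₀ hd0] at hmlt
        have hm1' : (1 : ℝ) ≤ m := by exact_mod_cast hm1
        nlinarith
      have hρ : |(harmonic m : ℝ) - (Real.log x - Real.log d + γ)| ≤ 2 * d / x := by
        rw [abs_le]; constructor <;> linarith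
      have hχ1 : |(χ (d : ZMod q)).re| ≤ 1 :=
        (Complex.abs_re_le_norm _).trans (DirichletCharacter.norm_le_one χ _)
      have e : (χ (d : ZMod q)).re / d * (harmonic m : ℝ) -
          ((Real.log x + γ) * ((χ (d : ZMod q)).re / d) - (χ (d : ZMod q)).re * (Real.log d / d)) =
          (χ (d : ZMod q)).re / d * ((harmonic m : ℝ) - (Real.log x - Real.log d + γ)) := by ring
      rw [e, abs_mul, abs_div, abs_of_pos hd0]
      calc |(χ (d : ZMod q)).re| / d * |(harmonic m : ℝ) - (Real.log x - Real.log d + γ)|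
          ≤ 1 / d * (2 * d / x) :=
            mul_le_mul (div_le_div_of_nonneg_right hχ1 hd0.le) hρ (abs_nonneg _) (by positivity)
        _ = 2 / x := by field_simp
    have hsum : ∑ d ∈ Icc 1 y, (χ (d : ZMod q)).re / d * (harmonic (x / d) : ℝ) - ((Real.log x + γ) * A - B) =
        ∑ d ∈ Icc 1 y, ((χ (d : ZMod q)).re / d * (harmonic (x / d) : ℝ) -
          ((Real.log x + γ) * ((χ (d : ZMod q)).re / d) - (χ (d : ZMod q)).re * (Real.log d / d))) := by
      rw [hA, hB, Finset.mul_sum, ← Finset.sum_sub_distrib, ← Finset.sum_sub_distrib]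
    rw [hsum]
    calc |∑ d ∈ Icc 1 y, ((χ (d : ZMod q)).re / d * (harmonic (x / d) : ℝ) -
          ((Real.log x + γ) * ((χ (d : ZMod q)).re / d) - (χ (d : ZMod q)).re * (Real.log d / d)))|
        ≤ ∑ d ∈ Icc 1 y, |(χ (d : ZMod q)).re / d * (harmonic (x / d) : ℝ) -
          ((Real.log x + γ) * ((χ (d : ZMod q)).re / d) - (χ (d : ZMod q)).re * (Real.log d / d))| :=
          Finset.abs_sum_le_sum_abs _ _
      _ ≤ ∑ d ∈ Icc 1 y, (2 : ℝ) / x := Finset.sum_le_sum hterm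
      _ = 2 * y / x := by
          rw [Finset.sum_const, Nat.card_Icc, nsmul_eq_mul]
          push_cast
          ring
  -- (5) combine
  have hmain : ∑ n ∈ Icc 1 x, (χ.zetaMul n).re / n - (L₁' + (Real.log x + γ) * L₁) =
      (∑ d ∈ Icc 1 y, (χ (d : ZMod q)).re / d * (harmonic (x / d) : ℝ) - ((Real.log x + γ) * A - B)) +
        ∑ d ∈ Ioc y x, (χ (d : ZMod q)).re / d * (harmonic (x / d) : ℝ) +
        ((Real.log x + γ) * (A - L₁) - (B + L₁')) := by
    rw [hsplit]; ring
  rw [hmain]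
  have hlg : 0 ≤ Real.log x + γ := by linarith
  have h3 : |(Real.log x + γ) * (A - L₁) - (B + L₁')| ≤
      (Real.log x + 1) * (W / ((y : ℝ) + 1)) + W * (1 + Real.log x) / ((y : ℝ) + 1) := by
    calc |(Real.log x + γ) * (A - L₁) - (B + L₁')|
        ≤ |(Real.log x + γ) * (A - L₁)| + |B + L₁'| := abs_sub _ _
      _ = (Real.log x + γ) * |A - L₁| + |B + L₁'| := by rw [abs_mul, abs_of_nonneg hlg]
      _ ≤ (Real.log x + 1) * (W / ((y : ℝ) + 1)) + W * (1 + Real.log x) / ((y : ℝ) + 1) := by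
          have h1 : (Real.log x + γ) * |A - L₁| ≤ (Real.log x + 1) * (W / ((y : ℝ) + 1)) :=
            mul_le_mul (by linarith) hAL (abs_nonneg _) (by linarith)
          linarith [hBL]
  calc |(∑ d ∈ Icc 1 y, (χ (d : ZMod q)).re / d * (harmonic (x / d) : ℝ) - ((Real.log x + γ) * A - B)) +
        ∑ d ∈ Ioc y x, (χ (d : ZMod q)).re / d * (harmonic (x / d) : ℝ) +
        ((Real.log x + γ) * (A - L₁) - (B + L₁'))|
      ≤ |∑ d ∈ Icc 1 y, (χ (d : ZMod q)).re / d * (harmonic (x / d) : ℝ) - ((Real.log x + γ) * A - B)| +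
        |∑ d ∈ Ioc y x, (χ (d : ZMod q)).re / d * (harmonic (x / d) : ℝ)| +
        |(Real.log x + γ) * (A - L₁) - (B + L₁')| := abs_add_three _ _ _
    _ ≤ 2 * y / x + W * (1 + Real.log x) / ((y : ℝ) + 1) +
        ((Real.log x + 1) * (W / ((y : ℝ) + 1)) + W * (1 + Real.log x) / ((y : ℝ) + 1)) := by
        gcongr
    _ = 3 * W * (1 + Real.log x) / (y + 1) + 2 * y / x := by ring

end Literature.NumberTheory.LFunctions.ZetaMulHarmonic
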